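import Summits.QuantumFields.YangMills.Theses.FradkinShenkerFlow
import Summits.QuantumFields.YangMills.Theorems.FradkinShenkerFlowSusceptibilityToPoincareOrbitSliceSplit
import Literature.MathematicalPhysics.QuantumFieldTheory.LatticeGaugeProofs
import Literature.MathematicalPhysics.QuantumFieldTheory.StrongCouplingActivities

/-!
# Stub `stub_dirichlet_orbitAverage_le` of the line `orbit-slice-reduction`

Crux `SusceptibilityToPoincare` of the route `FradkinShenkerFlow` of `YangMills`, item
`stmt-QuantumFields-9441`
(`Summit.QuantumFields.YangMills.Theses.FradkinShenkerFlow.SusceptibilityToPoincare`, FS ⇒ UP).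
This file proves part (3) of the transfer `UP_inv ⇒ UP` of the registered skeleton
`Cruxes/SusceptibilityToPoincare/Lines/orbit-slice-reduction.lean`: **orbit averaging contracts
the single-link heat-bath Dirichlet form**, `ℰ_hb(F̄) ≤ ℰ_hb(F)`, where for the 4D torus of side
`2S+1`, the Wilson measure `μ = wilsonMeasure r.ρ β`, the one-link heat-bath laws
`ν_ℓ^U = Haar.tilted (g' ↦ -β S_W(U[ℓ ↦ g']))` and a bounded measurable `F`,

  `ℰ_hb(F) = ∑_ℓ ∫∫ (F U − F (U[ℓ ↦ g]))² dν_ℓ^U(g) dμ(U)`,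

and `F̄ U = ∫ F(U^k) dπ(k)` is the orbit average over the product Haar probability measure
`π = Haar^{⊗ sites}` of the gauge group.

## Proof

Termwise in `ℓ`. The abstract part (`DirichletOrbit.integral_integral_sq_orbitAverage_sub_le`):
for probability spaces `(Ω, μ)`, `(K, π)`, finite sub-probability "resampling laws" `ν ω` on a
space `Γ`, a jointly measurable `μ`-invariant action `act`, a jointly measurable update map
`upd : Ω → Γ → Ω` and bounded measurable `F`,
* Jensen in `k`: `(F̄ ω − F̄ (upd ω g))² ≤ ∫ (F(act k ω) − F(act k (upd ω g)))² dπ(k)`;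
* Fubini in `(g, k)` and the **covariance hypothesis**
  `∫ (F(act k ω) − F(act k (upd ω g)))² dν(ω)(g) = B(act k ω)`,
  `B ω := ∫ (F ω − F(upd ω g))² dν(ω)(g)`, give the pointwise bound `≤ ∫ B(act k ω) dπ(k)`;
* Fubini in `(ω, k)` and invariance of `μ` give `∫∫ B(act k ω) dπ dμ = ∫ B dμ`.
The lattice instance: `act k U = U^k` (`continuous_gaugeAction_univ`, measurable by second
countability of `G` through `r`), `upd U g = U[ℓ ↦ g]`, `μ` gauge invariant
(`integral_comp_gaugeTransform_wilsonMeasure`), `B` measurable after expanding the tilted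
integral against Haar (`integral_tilted`), and the covariance hypothesis is the **gauge covariance
of the heat-bath law** (`DirichletOrbit.integral_heatBath_gaugeTransform`): with `a = k ℓ.1`,
`b = k (ℓ.1 + e_{ℓ.2})`, `(U[ℓ ↦ g])^k = U^k[ℓ ↦ a g b⁻¹]` (`DirichletOrbit.gaugeTransform_update`),
the potential of `ν_ℓ^U` is that of `ν_ℓ^{U^k}` composed with `g ↦ a g b⁻¹`
(`wilsonAction_gaugeTransform`), and tilting Haar commutes with two-sided translations
(`DirichletOrbit.integral_comp_conj_tilted`, from `integral_haar_conj_eq`).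
-/

noncomputable section

open MeasureTheory ProbabilityTheory
open Literature.MathematicalPhysics.QuantumFieldTheory

namespace Summit.QuantumFields.YangMills.Theorems.SusceptibilityToPoincare

namespace DirichletOrbit

/-! ### Abstract probability -/

section Abstract

/-- A difference of two values of a function bounded by `M` has square of norm at most
`(|M| + |M|)²`. [folklore] -/
theorem norm_sq_sub_le {α : Type*} {F : α → ℝ} {M : ℝ} (hM : ∀ ω, |F ω| ≤ M) (x y : α) :
    ‖(F x - F y) ^ 2‖ ≤ (|M| + |M|) ^ 2 := by
  rw [norm_pow, Real.norm_eq_abs]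
  exact pow_le_pow_left₀ (abs_nonneg _) ((abs_sub _ _).trans
    (add_le_add ((hM x).trans (le_abs_self M)) ((hM y).trans (le_abs_self M)))) 2

variable {Ω K Γ : Type*} [MeasurableSpace Ω] [MeasurableSpace K] [MeasurableSpace Γ]

/-- **Jensen for the square** on a probability space: `(∫ X)² ≤ ∫ X²` for bounded measurable `X`
(bias–variance with centring constant `0` and `0 ≤ Var X`). [folklore] -/
theorem sq_integral_le_integral_sq {π : Measure K} [IsProbabilityMeasure π] {X : K → ℝ}
    (hX : Measurable X) {C : ℝ} (hC : ∀ k, |X k| ≤ C) :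
    (∫ k, X k ∂π) ^ 2 ≤ ∫ k, (X k) ^ 2 ∂π := by
  have h := integral_sub_sq_eq_variance_add_sq (π := π) hX hC 0
  simp only [sub_zero] at h
  rw [h]
  linarith [variance_nonneg X π]

/-- **Orbit averaging contracts a covariant resampling Dirichlet form** (abstract form). Let
`(Ω, μ)`, `(K, π)` be probability spaces, `ν ω` (`ω ∈ Ω`) sub-probability measures on `Γ`,
`act : K → Ω → Ω` a jointly measurable action leaving all `μ`-integrals invariant,
`upd : Ω → Γ → Ω` jointly measurable, `F` bounded measurable with orbit average
`F̄ ω = ∫ F(act k ω) dπ(k)`, and `B ω = ∫ (F ω − F(upd ω g))² dν(ω)(g)` measurable. If the laws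
are covariant along the action in the sense
`∫ (F(act k ω) − F(act k (upd ω g)))² dν(ω)(g) = B(act k ω)`, then
`∫∫ (F̄ ω − F̄(upd ω g))² dν(ω) dμ ≤ ∫ B dμ` (Jensen in `k`, Fubini twice, invariance of `μ`).
[folklore] -/
theorem integral_integral_sq_orbitAverage_sub_le {μ : Measure Ω} {π : Measure K}
    [IsProbabilityMeasure μ] [IsProbabilityMeasure π] {ν : Ω → Measure Γ}
    [∀ ω, IsZeroOrProbabilityMeasure (ν ω)]
    {act : K → Ω → Ω} (hact : Measurable fun p : K × Ω => act p.1 p.2)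
    (hinv : ∀ (k : K) (f : Ω → ℝ), ∫ ω, f (act k ω) ∂μ = ∫ ω, f ω ∂μ)
    {upd : Ω → Γ → Ω} (hupd : Measurable fun p : Ω × Γ => upd p.1 p.2)
    {F : Ω → ℝ} (hF : Measurable F) {M : ℝ} (hM : ∀ ω, |F ω| ≤ M)
    (hB : Measurable fun ω => ∫ g, (F ω - F (upd ω g)) ^ 2 ∂(ν ω))
    (hcov : ∀ (k : K) (ω : Ω), ∫ g, (F (act k ω) - F (act k (upd ω g))) ^ 2 ∂(ν ω) =
      ∫ g, (F (act k ω) - F (upd (act k ω) g)) ^ 2 ∂(ν (act k ω))) :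
    ∫ ω, ∫ g, ((∫ k, F (act k ω) ∂π) - ∫ k, F (act k (upd ω g)) ∂π) ^ 2 ∂(ν ω) ∂μ ≤
      ∫ ω, ∫ g, (F ω - F (upd ω g)) ^ 2 ∂(ν ω) ∂μ := by
  have hFj : Measurable fun p : K × Ω => F (act p.1 p.2) := hF.comp hact
  have hbF : ∀ ω, ‖F ω‖ ≤ |M| := fun ω => by
    rw [Real.norm_eq_abs]; exact (hM ω).trans (le_abs_self M)
  have hsq : ∀ x y, ‖(F x - F y) ^ 2‖ ≤ (|M| + |M|) ^ 2 := norm_sq_sub_le hM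
  -- measurability of `k ↦ act k ω` and of `(g, k) ↦ act k (upd ω g)` for fixed `ω`
  have hA1 : ∀ ω, Measurable fun k : K => act k ω := fun ω =>
    hact.comp (measurable_id.prodMk measurable_const)
  have hA2 : ∀ ω, Measurable fun p : Γ × K => act p.2 (upd ω p.1) := fun ω =>
    hact.comp (measurable_snd.prodMk (hupd.comp (measurable_const.prodMk measurable_fst)))
  have hYm : ∀ ω, Measurable fun p : Γ × K => (F (act p.2 ω) - F (act p.2 (upd ω p.1))) ^ 2 :=
    fun ω => ((hF.comp ((hA1 ω).comp measurable_snd)).sub (hF.comp (hA2 ω))).pow_const 2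
  -- (1) Jensen in `k`, for fixed `ω` and `g`
  have hJ : ∀ ω g, ((∫ k, F (act k ω) ∂π) - ∫ k, F (act k (upd ω g)) ∂π) ^ 2 ≤
      ∫ k, (F (act k ω) - F (act k (upd ω g))) ^ 2 ∂π := fun ω g => by
    have hX1 : Measurable fun k => F (act k ω) := hF.comp (hA1 ω)
    have hX2 : Measurable fun k => F (act k (upd ω g)) :=
      hF.comp ((hA2 ω).comp (measurable_const.prodMk measurable_id))
    have hi1 : Integrable (fun k => F (act k ω)) π :=
      Integrable.of_bound hX1.aestronglyMeasurable |M| (ae_of_all _ fun k => hbF _)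
    have hi2 : Integrable (fun k => F (act k (upd ω g))) π :=
      Integrable.of_bound hX2.aestronglyMeasurable |M| (ae_of_all _ fun k => hbF _)
    rw [← integral_sub hi1 hi2]
    exact sq_integral_le_integral_sq (hX1.sub hX2) (C := |M| + |M|) fun k =>
      (abs_sub _ _).trans (add_le_add ((hM _).trans (le_abs_self M))
        ((hM _).trans (le_abs_self M)))
  -- (2) the pointwise bound `A ω ≤ ∫ B (act k ω) dπ(k)`
  have hpt : ∀ ω, ∫ g, ((∫ k, F (act k ω) ∂π) - ∫ k, F (act k (upd ω g)) ∂π) ^ 2 ∂(ν ω) ≤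
      ∫ k, ∫ g, (F (act k ω) - F (upd (act k ω) g)) ^ 2 ∂(ν (act k ω)) ∂π := fun ω => by
    have hgi : Integrable (fun g => ∫ k, (F (act k ω) - F (act k (upd ω g))) ^ 2 ∂π) (ν ω) :=
      Integrable.of_bound ((hYm ω).stronglyMeasurable.integral_prod_right'
          (ν := π)).aestronglyMeasurable ((|M| + |M|) ^ 2) (ae_of_all _ fun g => by
        have := norm_integral_le_of_norm_le_const (μ := π) (ae_of_all _ fun k => hsq _ _)
          (f := fun k => (F (act k ω) - F (act k (upd ω g))) ^ 2)
        simpa [probReal_univ] using this)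
    have hswap : ∫ g, ∫ k, (F (act k ω) - F (act k (upd ω g))) ^ 2 ∂π ∂(ν ω) =
        ∫ k, ∫ g, (F (act k ω) - F (act k (upd ω g))) ^ 2 ∂(ν ω) ∂π :=
      integral_integral_swap (Integrable.of_bound (hYm ω).aestronglyMeasurable ((|M| + |M|) ^ 2)
        (ae_of_all _ fun p => hsq _ _))
    calc ∫ g, ((∫ k, F (act k ω) ∂π) - ∫ k, F (act k (upd ω g)) ∂π) ^ 2 ∂(ν ω)
        ≤ ∫ g, ∫ k, (F (act k ω) - F (act k (upd ω g))) ^ 2 ∂π ∂(ν ω) :=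
          integral_mono_of_nonneg (ae_of_all _ fun g => sq_nonneg _) hgi
            (ae_of_all _ fun g => hJ ω g)
      _ = ∫ k, ∫ g, (F (act k ω) - F (upd (act k ω) g)) ^ 2 ∂(ν (act k ω)) ∂π := by
          rw [hswap]
          exact integral_congr_ae (ae_of_all _ fun k => hcov k ω)
  -- (3) integrate `dμ(ω)`, swap, and use the invariance of `μ`
  have hBb : ∀ ω, ‖∫ g, (F ω - F (upd ω g)) ^ 2 ∂(ν ω)‖ ≤ (|M| + |M|) ^ 2 := fun ω => by
    have h1 := norm_integral_le_of_norm_le_const (μ := ν ω) (ae_of_all _ fun g => hsq _ _)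
      (f := fun g => (F ω - F (upd ω g)) ^ 2)
    exact h1.trans (mul_le_of_le_one_right (sq_nonneg _) measureReal_le_one)
  have hDm : Measurable fun ω => ∫ k, ∫ g, (F (act k ω) - F (upd (act k ω) g)) ^ 2
      ∂(ν (act k ω)) ∂π := measurable_orbitAverage hact hB
  have hDi : Integrable (fun ω => ∫ k, ∫ g, (F (act k ω) - F (upd (act k ω) g)) ^ 2
      ∂(ν (act k ω)) ∂π) μ :=
    Integrable.of_bound hDm.aestronglyMeasurable ((|M| + |M|) ^ 2) (ae_of_all _ fun ω => by
      have := norm_integral_le_of_norm_le_const (μ := π) (ae_of_all _ fun k => hBb (act k ω))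
        (f := fun k => ∫ g, (F (act k ω) - F (upd (act k ω) g)) ^ 2 ∂(ν (act k ω)))
      simpa [probReal_univ] using this)
  have hprod : Integrable (Function.uncurry fun ω k =>
      ∫ g, (F (act k ω) - F (upd (act k ω) g)) ^ 2 ∂(ν (act k ω))) (μ.prod π) :=
    Integrable.of_bound ((hB.comp (hact.comp measurable_swap)).aestronglyMeasurable)
      ((|M| + |M|) ^ 2) (ae_of_all _ fun p => hBb _)
  have hnn : ∀ ω, 0 ≤ ∫ g, ((∫ k, F (act k ω) ∂π) - ∫ k, F (act k (upd ω g)) ∂π) ^ 2 ∂(ν ω) :=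
    fun ω => integral_nonneg fun g => sq_nonneg _
  calc ∫ ω, ∫ g, ((∫ k, F (act k ω) ∂π) - ∫ k, F (act k (upd ω g)) ∂π) ^ 2 ∂(ν ω) ∂μ
      ≤ ∫ ω, ∫ k, ∫ g, (F (act k ω) - F (upd (act k ω) g)) ^ 2 ∂(ν (act k ω)) ∂π ∂μ :=
        integral_mono_of_nonneg (ae_of_all _ hnn) hDi (ae_of_all _ hpt)
    _ = ∫ k, ∫ ω, ∫ g, (F (act k ω) - F (upd (act k ω) g)) ^ 2 ∂(ν (act k ω)) ∂μ ∂π :=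
        integral_integral_swap hprod
    _ = ∫ ω, ∫ g, (F ω - F (upd ω g)) ^ 2 ∂(ν ω) ∂μ := by
        have h1 : ∀ k, ∫ ω, ∫ g, (F (act k ω) - F (upd (act k ω) g)) ^ 2 ∂(ν (act k ω)) ∂μ =
            ∫ ω, ∫ g, (F ω - F (upd ω g)) ^ 2 ∂(ν ω) ∂μ := fun k =>
          hinv k fun ω => ∫ g, (F ω - F (upd ω g)) ^ 2 ∂(ν ω)
        simp only [h1, integral_const, probReal_univ, one_smul]

end Abstract

/-! ### Tilting Haar measure commutes with two-sided translations -/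

section Haar

variable {G : Type*} [Group G] [TopologicalSpace G] [IsTopologicalGroup G] [CompactSpace G]
  [MeasurableSpace G] [BorelSpace G]

/-- **Covariance of exponential tilting under two-sided translations of a compact group**:
`∫ ψ(a g b) d(Haar.tilted (f(a · b)))(g) = ∫ ψ d(Haar.tilted f)` — both sides are Haar
integrals of `(e^{f}/Z) ψ` after the substitution `g ↦ a g b`, which preserves the Haar
probability measure (`integral_haar_conj_eq`) and hence also the normalisation `Z`. No
measurability is needed. [folklore] -/
theorem integral_comp_conj_tilted (f ψ : G → ℝ) (a b : G) :
    ∫ g, ψ (a * g * b) ∂((haarProbability G).tilted fun g => f (a * g * b)) =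
      ∫ g, ψ g ∂((haarProbability G).tilted f) := by
  rw [integral_tilted, integral_tilted]
  have hZ : ∫ x, Real.exp (f (a * x * b)) ∂haarProbability G =
      ∫ x, Real.exp (f x) ∂haarProbability G :=
    integral_haar_conj_eq (fun g => Real.exp (f g)) a b
  rw [hZ]
  exact integral_haar_conj_eq
    (fun g => (Real.exp (f g) / ∫ x, Real.exp (f x) ∂haarProbability G) • ψ g) a b

end Haar

/-! ### The lattice instance -/

section Lattice

variable {d L : ℕ} {G : Type*} [Group G]

/-- **A gauge transformation of a one-link update is a one-link update of the gauge transform**: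
`(U[ℓ ↦ g])^k = U^k[ℓ ↦ k(x) g k(x + e_i)⁻¹]` for `ℓ = (x, i)`. [folklore] -/
theorem gaugeTransform_update [DecidableEq (Edge d L)] (k : Site d L → G) (U : GaugeConfig d L G)
    (ℓ : Edge d L) (g : G) :
    gaugeTransform k (Function.update U ℓ g) =
      Function.update (gaugeTransform k U) ℓ (k ℓ.1 * g * (k (ℓ.1.shift ℓ.2))⁻¹) := by
  funext e
  by_cases h : e = ℓ
  · subst h
    simp [gaugeTransform]
  · simp [gaugeTransform, Function.update_of_ne h]

variable [TopologicalSpace G] [IsTopologicalGroup G] [CompactSpace G] [MeasurableSpace G]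
  [BorelSpace G] {N : ℕ} (ρ : G →* Matrix (Fin N) (Fin N) ℂ) (β : ℝ)

/-- **Gauge covariance of the one-link heat-bath law.** For `V = U^k`, `a = k(x)`,
`b = k(x + e_i)`, `ℓ = (x, i)`:
`∫ (F V − F((U[ℓ ↦ g])^k))² dν_ℓ^U(g) = ∫ (F V − F(V[ℓ ↦ g']))² dν_ℓ^V(g')`,
because `(U[ℓ ↦ g])^k = V[ℓ ↦ a g b⁻¹]`, the potential satisfies
`-β S_W(U[ℓ ↦ g]) = -β S_W(V[ℓ ↦ a g b⁻¹])` (gauge invariance of the Wilson action), and tilting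
Haar commutes with `g ↦ a g b⁻¹`. [folklore] -/
theorem integral_heatBath_gaugeTransform [NeZero L] [DecidableEq (Edge d L)] (k : Site d L → G)
    (U : GaugeConfig d L G) (ℓ : Edge d L) (F : GaugeConfig d L G → ℝ) :
    ∫ g, (F (gaugeTransform k U) - F (gaugeTransform k (Function.update U ℓ g))) ^ 2
        ∂((haarProbability G).tilted fun g' => -β * wilsonAction ρ (Function.update U ℓ g')) =
      ∫ g, (F (gaugeTransform k U) - F (Function.update (gaugeTransform k U) ℓ g)) ^ 2
        ∂((haarProbability G).tilted fun g' =>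
          -β * wilsonAction ρ (Function.update (gaugeTransform k U) ℓ g')) := by
  have hupd : ∀ g, gaugeTransform k (Function.update U ℓ g) =
      Function.update (gaugeTransform k U) ℓ (k ℓ.1 * g * (k (ℓ.1.shift ℓ.2))⁻¹) :=
    gaugeTransform_update k U ℓ
  have hpot : (fun g' => -β * wilsonAction ρ (Function.update U ℓ g')) = fun g =>
      (fun g'' => -β * wilsonAction ρ (Function.update (gaugeTransform k U) ℓ g''))
        (k ℓ.1 * g * (k (ℓ.1.shift ℓ.2))⁻¹) := by
    funext g
    simp only
    rw [← hupd, wilsonAction_gaugeTransform]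
  simp only [hupd]
  rw [hpot]
  exact integral_comp_conj_tilted
    (fun g'' => -β * wilsonAction ρ (Function.update (gaugeTransform k U) ℓ g''))
    (fun g'' => (F (gaugeTransform k U) - F (Function.update (gaugeTransform k U) ℓ g'')) ^ 2)
    (k ℓ.1) (k (ℓ.1.shift ℓ.2))⁻¹

variable [SecondCountableTopology G]

/-- **Measurability of the one-link heat-bath Dirichlet density**
`U ↦ ∫ (F U − F(U[ℓ ↦ g]))² dν_ℓ^U(g)` for measurable `F` and continuous `ρ`: expand the tilted
integral against Haar (`integral_tilted`); the density `e^{-β S_W(U[ℓ ↦ g])}/Z_ℓ(U)` is jointly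
measurable in `(U, g)` (the normalisation by measurability of parametric integrals). [folklore] -/
theorem measurable_integral_heatBath [NeZero L] [DecidableEq (Edge d L)] (hρ : Continuous ρ)
    (ℓ : Edge d L) {F : GaugeConfig d L G → ℝ} (hF : Measurable F) :
    Measurable fun U : GaugeConfig d L G => ∫ g, (F U - F (Function.update U ℓ g)) ^ 2
      ∂((haarProbability G).tilted fun g' => -β * wilsonAction ρ (Function.update U ℓ g')) := by
  have hupdm : Measurable fun p : GaugeConfig d L G × G => Function.update p.1 ℓ p.2 :=
    measurable_update'
  have hf : Measurable fun p : GaugeConfig d L G × G =>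
      -β * wilsonAction ρ (Function.update p.1 ℓ p.2) :=
    ((measurable_wilsonAction ρ hρ).comp hupdm).const_mul (-β)
  have hZ : Measurable fun U : GaugeConfig d L G =>
      ∫ x, Real.exp (-β * wilsonAction ρ (Function.update U ℓ x)) ∂haarProbability G :=
    (hf.exp.stronglyMeasurable.integral_prod_right' (ν := haarProbability G)).measurable
  have hint : Measurable fun p : GaugeConfig d L G × G =>
      (Real.exp (-β * wilsonAction ρ (Function.update p.1 ℓ p.2)) /
        ∫ x, Real.exp (-β * wilsonAction ρ (Function.update p.1 ℓ x)) ∂haarProbability G) *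
      (F p.1 - F (Function.update p.1 ℓ p.2)) ^ 2 :=
    (hf.exp.div (hZ.comp measurable_fst)).mul
      (((hF.comp measurable_fst).sub (hF.comp hupdm)).pow_const 2)
  have heq : (fun U : GaugeConfig d L G => ∫ g, (F U - F (Function.update U ℓ g)) ^ 2
      ∂((haarProbability G).tilted fun g' => -β * wilsonAction ρ (Function.update U ℓ g'))) =
      fun U => ∫ g, (Real.exp (-β * wilsonAction ρ (Function.update U ℓ g)) /
        ∫ x, Real.exp (-β * wilsonAction ρ (Function.update U ℓ x)) ∂haarProbability G) *
      (F U - F (Function.update U ℓ g)) ^ 2 ∂haarProbability G := by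
    funext U
    rw [integral_tilted]
    rfl
  rw [heq]
  exact (hint.stronglyMeasurable.integral_prod_right' (ν := haarProbability G)).measurable

/-- **Orbit averaging contracts the heat-bath Dirichlet form, one link at a time**: for the
Wilson measure `μ = wilsonMeasure ρ β` (continuous `ρ`), the product Haar probability measure `π`
on the gauge group, bounded measurable `F` and every edge `ℓ`,
`∫∫ (F̄ U − F̄(U[ℓ ↦ g]))² dν_ℓ^U dμ ≤ ∫∫ (F U − F(U[ℓ ↦ g]))² dν_ℓ^U dμ`. [folklore] -/
theorem integral_integral_sq_orbitAverage_sub_le_heatBath [NeZero L] [DecidableEq (Edge d L)]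
    (hρ : Continuous ρ) (ℓ : Edge d L) {F : GaugeConfig d L G → ℝ} (hF : Measurable F) {M : ℝ}
    (hM : ∀ U, |F U| ≤ M) :
    ∫ U, ∫ g, ((∫ k, F (gaugeTransform k U) ∂(Measure.pi fun _ : Site d L => haarProbability G)) -
          (∫ k, F (gaugeTransform k (Function.update U ℓ g))
            ∂(Measure.pi fun _ : Site d L => haarProbability G))) ^ 2
        ∂((haarProbability G).tilted fun g' => -β * wilsonAction ρ (Function.update U ℓ g'))
        ∂(wilsonMeasure (d := d) (L := L) ρ β) ≤
      ∫ U, ∫ g, (F U - F (Function.update U ℓ g)) ^ 2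
        ∂((haarProbability G).tilted fun g' => -β * wilsonAction ρ (Function.update U ℓ g'))
        ∂(wilsonMeasure (d := d) (L := L) ρ β) := by
  haveI : IsProbabilityMeasure (wilsonMeasure (d := d) (L := L) ρ β) :=
    isProbabilityMeasure_wilsonMeasure (d := d) (L := L) ρ hρ β
  have hact : Measurable fun p : (Site d L → G) × GaugeConfig d L G => gaugeTransform p.1 p.2 :=
    (continuous_gaugeAction_univ (d := d) (L := L) (G := G)).measurable
  have hinv : ∀ (k : Site d L → G) (f : GaugeConfig d L G → ℝ),
      ∫ U, f (gaugeTransform k U) ∂(wilsonMeasure (d := d) (L := L) ρ β) =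
        ∫ U, f U ∂(wilsonMeasure (d := d) (L := L) ρ β) := fun k f =>
    integral_comp_gaugeTransform_wilsonMeasure ρ β k f
  have hupd : Measurable fun p : GaugeConfig d L G × G => Function.update p.1 ℓ p.2 :=
    measurable_update'
  exact integral_integral_sq_orbitAverage_sub_le
    (ν := fun U : GaugeConfig d L G =>
      (haarProbability G).tilted fun g' => -β * wilsonAction ρ (Function.update U ℓ g'))
    (upd := fun (U : GaugeConfig d L G) (g : G) => Function.update U ℓ g)
    hact hinv hupd hF hM (measurable_integral_heatBath ρ β hρ ℓ hF)
    fun k U => integral_heatBath_gaugeTransform ρ β k U ℓ F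

end Lattice

end DirichletOrbit

/-! ### The registered stub -/

/-- `stub_dirichlet_orbitAverage_le` — **orbit averaging contracts the heat-bath Dirichlet form**
(part (3) of the transfer `UP_inv ⇒ UP` of the line `orbit-slice-reduction`). For every compact
group `G` with a lattice representation `r`, every real `β`, every side `2S+1` and every bounded
measurable `F` on the configurations of the 4D torus, with `F̄ U = ∫ F(U^k) dπ(k)` the orbit
average over the product Haar probability measure `π = Haar^{⊗ sites}` and
`ν_ℓ^U = Haar.tilted (g' ↦ -β S_W(U[ℓ ↦ g']))` the one-link heat-bath laws of the Wilson measure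
`μ = wilsonMeasure r.ρ β`:
`∑_ℓ ∫∫ (F̄ U − F̄(U[ℓ ↦ g]))² dν_ℓ^U dμ ≤ ∑_ℓ ∫∫ (F U − F(U[ℓ ↦ g]))² dν_ℓ^U dμ`
(termwise: Jensen in `k`, gauge covariance of the heat-bath law, gauge invariance of `μ`).
[folklore] -/
theorem stub_dirichlet_orbitAverage_le :
    ∀ (G : Type) [Group G] [TopologicalSpace G] [IsTopologicalGroup G] [CompactSpace G]
      [MeasurableSpace G] [BorelSpace G] (r : LatticeRep G) (β : ℝ) (S : ℕ)
      (F : GaugeConfig 4 (2 * S + 1) G → ℝ), Measurable F → (∃ M : ℝ, ∀ U, |F U| ≤ M) →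
      (∑ ℓ : Edge 4 (2 * S + 1), ∫ U, ∫ g,
          ((∫ k, F (gaugeTransform k U) ∂(Measure.pi fun _ : Site 4 (2 * S + 1) => haarProbability G)) -
            (∫ k, F (gaugeTransform k (Function.update U ℓ g))
              ∂(Measure.pi fun _ : Site 4 (2 * S + 1) => haarProbability G))) ^ 2
        ∂((haarProbability G).tilted (fun g' => -β * wilsonAction r.ρ (Function.update U ℓ g')))
        ∂(wilsonMeasure r.ρ β : Measure (GaugeConfig 4 (2 * S + 1) G))) ≤
      ∑ ℓ : Edge 4 (2 * S + 1), ∫ U, ∫ g, (F U - F (Function.update U ℓ g)) ^ 2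
        ∂((haarProbability G).tilted (fun g' => -β * wilsonAction r.ρ (Function.update U ℓ g')))
        ∂(wilsonMeasure r.ρ β : Measure (GaugeConfig 4 (2 * S + 1) G)) := by
  intro G _ _ _ _ _ _ r β S F hF hM
  obtain ⟨M, hM⟩ := hM
  haveI : SecondCountableTopology G :=
    (r.continuous.isClosedEmbedding r.injective).isEmbedding.secondCountableTopology
  exact Finset.sum_le_sum fun ℓ _ =>
    DirichletOrbit.integral_integral_sq_orbitAverage_sub_le_heatBath r.ρ β r.continuous ℓ hF hM

end Summit.QuantumFields.YangMills.Theorems.SusceptibilityToPoincare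

end
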